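import Summits.CriticalPhenomena.PercolationContinuityZ3.Theorems.Transplant.FKConnectivityAllQForestTreeLevelPairCell
import HarnessLib

/-!
# Tree level of the square-free adjacent forest Rayleigh node, part 3/4: the FAR-VERTEX STEPS, the degree count, and an END of degree ≤ 2

Support file (`--supports stmt-CriticalPhenomena-4575`), FK sub-lane `prim-bschramm-fk-1` (generation 29) of the post-continuity
programme; builds on p205010 (kernel theorem, internal audit signed; external expert review pending).  No definitions, no named facts,
no sorries; standard axioms.  Parts: `…ForestTreeLevelTools` (1), `…ForestTreeLevelPairCell` (2), this file (3), `…ForestTreeLevel` (4).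

Given the tree-level inequality one vertex down (support `T`), a far vertex `z ∉ {o, v, y}` of weighted degree `2` or `3` is
eliminated: **`treeLevel_step_claw`** (three free pairs: claw decomposition `fibreCount_forest_claw_decomp`, claw cells vanish by
`fibreCount_sep₃_eq_zero_of_nearTight`, pair cells by `treeLevel_pairCell_le`), **`treeLevel_step_degTwo`** (two free pairs, the
`S_ab` cells vanish on the tight rest), **`treeLevel_step_pendant`** (one pinned pair), **`treeLevel_step_mixed`** (one free, one
pinned pair); a far vertex of degree `≤ 1` kills every valid colouring (**`treeLevel_bad_eq_zero_of_isolated`**,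
**`treeLevel_bad_eq_zero_of_degOne`**).  Degrees: the handshake **`sum_card_filter_mem_eq`** (`Σ_{w ∈ S} #{g ∈ F : w ∈ g} = 2|F|`)
and the extraction of the pairs at a vertex of free/pinned degree `0, 1, 2, 3` (`isolated_of_card_filter_eq_zero`,
`exists_of_card_filter_eq_one/two/three`, `two_le_card_filter`).  Finally **`treeLevel_of_lowEnd`** — Cibulka–Hladký–LaCroix–Wagner's
Case 2(ii) at tree level: if the end `v` of `e = ov` meets at most two pairs of the tight fibre (pinned pairs counted twice) then `bad ≤ good`
(one pair: no valid colouring through `e, f`; two pairs `e, g`: the colourings with `g ∈ ω` vanish, the others inject into `good` by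
`adjForestNoSq_bad_sdiff_le_good_of_degTwo`).
[cite: CibulkaHladkyLaCroixWagner2008, Thm. 1 (p. 2), Cases 0–3 (pp. 4–5)] [cite: Linusson2011, Prop. 2.6] [cite: Grimmett2006, §1.5 (p. 13)]
-/

noncomputable section

namespace Summit.CriticalPhenomena.PercolationContinuityZ3.Theorems
namespace FK

open MeasureTheory Set Literature.Probability.LatticeModels Literature.Probability.Percolation
open scoped Classical symmDiff

variable {V : Type*} [Fintype V]

/-! ### The far-vertex steps -/

section Steps

variable {T : Finset V} {o v y : V}

/-- **Claw step** (far vertex with three free pairs).  [cite: CibulkaHladkyLaCroixWagner2008, Case 3 (pp. 4–5)] [cite: Linusson2011, Prop. 2.6] -/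
theorem treeLevel_step_claw (IHT : ∀ (N u : BondConfig V), Disjoint u N → (∀ g ∈ N ∪ u, ∀ w ∈ g, w ∈ T) →
      2 * T.card ≤ N.ncard + 2 * u.ncard + 2 →
      fibreCount N u (forestEv V ∩ {ω | s(o, v) ∈ ω ∧ s(o, y) ∈ ω}) (forestEv V) ≤
        fibreCount N u (forestEv V ∩ {ω | s(o, v) ∈ ω}) (forestEv V ∩ {ω | s(o, y) ∈ ω})) {M' u₀ : BondConfig V} {z a b c : V} (hd : Disjoint u₀ M')
    (hz : ∀ g ∈ M' ∪ u₀, z ∉ g) (hza : z ≠ a) (hzb : z ≠ b) (hzc : z ≠ c) (hab : a ≠ b) (hac : a ≠ c) (hbc : b ≠ c)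
    (hzo : z ≠ o) (hzv : z ≠ v) (hzy : z ≠ y) (hT : ∀ g ∈ M' ∪ u₀, ∀ w ∈ g, w ∈ T) (ha : a ∈ T) (hb : b ∈ T) (hc : c ∈ T)
    (hnt : 2 * T.card ≤ M'.ncard + 2 * u₀.ncard + 3) (he : s(o, v) ∈ M') (hf : s(o, y) ∈ M') (hvy : v ≠ y) :
    fibreCount (insert s(z, a) (insert s(z, b) (insert s(z, c) M'))) u₀ (forestEv V ∩ {ω | s(o, v) ∈ ω ∧ s(o, y) ∈ ω}) (forestEv V) ≤
      fibreCount (insert s(z, a) (insert s(z, b) (insert s(z, c) M'))) u₀ (forestEv V ∩ {ω | s(o, v) ∈ ω})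
        (forestEv V ∩ {ω | s(o, y) ∈ ω}) := by
  have hPa := insert_mem_pairEv₂_iff (mk_ne_of_far (a := a) hzo hzv) (mk_ne_of_far (a := a) hzo hzy)
  have hPb := insert_mem_pairEv₂_iff (mk_ne_of_far (a := b) hzo hzv) (mk_ne_of_far (a := b) hzo hzy)
  have hPc := insert_mem_pairEv₂_iff (mk_ne_of_far (a := c) hzo hzv) (mk_ne_of_far (a := c) hzo hzy)
  have hEa := insert_mem_pairEv_iff (mk_ne_of_far (a := a) hzo hzv)
  have hEb := insert_mem_pairEv_iff (mk_ne_of_far (a := b) hzo hzv)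
  have hEc := insert_mem_pairEv_iff (mk_ne_of_far (a := c) hzo hzv)
  have hFa := insert_mem_pairEv_iff (mk_ne_of_far (a := a) hzo hzy)
  have hFb := insert_mem_pairEv_iff (mk_ne_of_far (a := b) hzo hzy)
  have hFc := insert_mem_pairEv_iff (mk_ne_of_far (a := c) hzo hzy)
  have hU : ∀ x : V, ∀ ω, insert s(z, x) ω ∈ (univ : Set (BondConfig V)) ↔ ω ∈ (univ : Set (BondConfig V)) := fun _ _ => by simp
  have hb0 : fibreCount (insert s(z, a) (insert s(z, b) (insert s(z, c) M'))) u₀ (forestEv V ∩ {ω | s(o, v) ∈ ω ∧ s(o, y) ∈ ω})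
      (forestEv V) = fibreCount (insert s(z, a) (insert s(z, b) (insert s(z, c) M'))) u₀
      (forestEv V ∩ {ω | s(o, v) ∈ ω ∧ s(o, y) ∈ ω}) (forestEv V ∩ univ) := by rw [inter_univ]
  rw [hb0, fibreCount_forest_claw_decomp hz hza hzb hzc hab hac hbc hPa hPb hPc (hU a) (hU b) (hU c),
    fibreCount_forest_claw_decomp hz hza hzb hzc hab hac hbc hEa hEb hEc hFa hFb hFc]
  have v1 := fibreCount_sep₃_eq_zero_of_nearTight hT hnt ha hb hc {ω | s(o, v) ∈ ω ∧ s(o, y) ∈ ω} (univ : Set (BondConfig V))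
  have v2 := fibreCount_sep₃_eq_zero_of_nearTight' hT hnt ha hb hc {ω | s(o, v) ∈ ω ∧ s(o, y) ∈ ω} (univ : Set (BondConfig V))
  have c1 := treeLevel_pairCell_le IHT hd hT hnt he hf hvy ha hb hab
  have c2 := treeLevel_pairCell_le IHT hd hT hnt he hf hvy ha hc hac
  have c3 := treeLevel_pairCell_le IHT hd hT hnt he hf hvy hb hc hbc
  rw [v1, v2]
  omega

/-- **Degree-two step** (far vertex with two free pairs).  [cite: CibulkaHladkyLaCroixWagner2008, Case 2(i) (p. 4)] [cite: Linusson2011, Prop. 2.6] -/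
theorem treeLevel_step_degTwo (IHT : ∀ (N u : BondConfig V), Disjoint u N → (∀ g ∈ N ∪ u, ∀ w ∈ g, w ∈ T) →
      2 * T.card ≤ N.ncard + 2 * u.ncard + 2 →
      fibreCount N u (forestEv V ∩ {ω | s(o, v) ∈ ω ∧ s(o, y) ∈ ω}) (forestEv V) ≤
        fibreCount N u (forestEv V ∩ {ω | s(o, v) ∈ ω}) (forestEv V ∩ {ω | s(o, y) ∈ ω})) {M' u₀ : BondConfig V} {z a b : V} (hd : Disjoint u₀ M')
    (hz : ∀ g ∈ M' ∪ u₀, z ∉ g) (hza : z ≠ a) (hzb : z ≠ b) (hab : a ≠ b) (hzo : z ≠ o) (hzv : z ≠ v) (hzy : z ≠ y)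
    (hT : ∀ g ∈ M' ∪ u₀, ∀ w ∈ g, w ∈ T) (ha : a ∈ T) (hb : b ∈ T) (ht : 2 * T.card ≤ M'.ncard + 2 * u₀.ncard + 2) :
    fibreCount (insert s(z, a) (insert s(z, b) M')) u₀ (forestEv V ∩ {ω | s(o, v) ∈ ω ∧ s(o, y) ∈ ω}) (forestEv V) ≤
      fibreCount (insert s(z, a) (insert s(z, b) M')) u₀ (forestEv V ∩ {ω | s(o, v) ∈ ω}) (forestEv V ∩ {ω | s(o, y) ∈ ω}) := by
  have hPa := insert_mem_pairEv₂_iff (mk_ne_of_far (a := a) hzo hzv) (mk_ne_of_far (a := a) hzo hzy)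
  have hPb := insert_mem_pairEv₂_iff (mk_ne_of_far (a := b) hzo hzv) (mk_ne_of_far (a := b) hzo hzy)
  have hEa := insert_mem_pairEv_iff (mk_ne_of_far (a := a) hzo hzv)
  have hEb := insert_mem_pairEv_iff (mk_ne_of_far (a := b) hzo hzv)
  have hFa := insert_mem_pairEv_iff (mk_ne_of_far (a := a) hzo hzy)
  have hFb := insert_mem_pairEv_iff (mk_ne_of_far (a := b) hzo hzy)
  have hU : ∀ x : V, ∀ ω, insert s(z, x) ω ∈ (univ : Set (BondConfig V)) ↔ ω ∈ (univ : Set (BondConfig V)) := fun _ _ => by simp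
  have hb0 : fibreCount (insert s(z, a) (insert s(z, b) M')) u₀ (forestEv V ∩ {ω | s(o, v) ∈ ω ∧ s(o, y) ∈ ω}) (forestEv V) =
      fibreCount (insert s(z, a) (insert s(z, b) M')) u₀ (forestEv V ∩ {ω | s(o, v) ∈ ω ∧ s(o, y) ∈ ω}) (forestEv V ∩ univ) := by
    rw [inter_univ]
  rw [hb0, fibreCount_forest_degTwo_decomp hz hza hzb hab hPa hPb (hU a) (hU b),
    fibreCount_forest_degTwo_decomp hz hza hzb hab hEa hEb hFa hFb,
    fibreCount_sep_eq_zero_of_tight hT ht ha hb, fibreCount_sep_eq_zero_of_tight' hT ht ha hb,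
    fibreCount_sep_eq_zero_of_tight hT ht ha hb, fibreCount_sep_eq_zero_of_tight' hT ht ha hb, inter_univ]
  have IH' := IHT M' u₀ hd hT ht
  omega

/-- **Pendant step** (far vertex with one pinned pair).  [cite: CibulkaHladkyLaCroixWagner2008, §2 (p. 3)] [cite: Linusson2011, Prop. 2.6] -/
theorem treeLevel_step_pendant (IHT : ∀ (N u : BondConfig V), Disjoint u N → (∀ g ∈ N ∪ u, ∀ w ∈ g, w ∈ T) →
      2 * T.card ≤ N.ncard + 2 * u.ncard + 2 →
      fibreCount N u (forestEv V ∩ {ω | s(o, v) ∈ ω ∧ s(o, y) ∈ ω}) (forestEv V) ≤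
        fibreCount N u (forestEv V ∩ {ω | s(o, v) ∈ ω}) (forestEv V ∩ {ω | s(o, y) ∈ ω})) {M' u₀ : BondConfig V} {z h : V} (hd : Disjoint u₀ M')
    (hz : ∀ g ∈ M' ∪ u₀, z ∉ g) (hzh : z ≠ h) (hzo : z ≠ o) (hzv : z ≠ v) (hzy : z ≠ y)
    (hT : ∀ g ∈ M' ∪ u₀, ∀ w ∈ g, w ∈ T) (ht : 2 * T.card ≤ M'.ncard + 2 * u₀.ncard + 2) :
    fibreCount M' (insert s(z, h) u₀) (forestEv V ∩ {ω | s(o, v) ∈ ω ∧ s(o, y) ∈ ω}) (forestEv V) ≤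
      fibreCount M' (insert s(z, h) u₀) (forestEv V ∩ {ω | s(o, v) ∈ ω}) (forestEv V ∩ {ω | s(o, y) ∈ ω}) := by
  have hPh := insert_mem_pairEv₂_iff (mk_ne_of_far (a := h) hzo hzv) (mk_ne_of_far (a := h) hzo hzy)
  have hEh := insert_mem_pairEv_iff (mk_ne_of_far (a := h) hzo hzv)
  have hFh := insert_mem_pairEv_iff (mk_ne_of_far (a := h) hzo hzy)
  have hU : ∀ ω, insert s(z, h) ω ∈ (univ : Set (BondConfig V)) ↔ ω ∈ (univ : Set (BondConfig V)) := fun _ => by simp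
  have hb0 : fibreCount M' (insert s(z, h) u₀) (forestEv V ∩ {ω | s(o, v) ∈ ω ∧ s(o, y) ∈ ω}) (forestEv V) =
      fibreCount M' (insert s(z, h) u₀) (forestEv V ∩ {ω | s(o, v) ∈ ω ∧ s(o, y) ∈ ω}) (forestEv V ∩ univ) := by
    rw [inter_univ]
  rw [hb0, fibreCount_forest_pendantPinned hz hzh hPh hU, fibreCount_forest_pendantPinned hz hzh hEh hFh, inter_univ]
  exact IHT M' u₀ hd hT ht

/-- **Mixed step** (far vertex with one free and one pinned pair).  [cite: CibulkaHladkyLaCroixWagner2008, Case 3 (pp. 4–5)] [cite: Linusson2011, Prop. 2.6] -/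
theorem treeLevel_step_mixed (IHT : ∀ (N u : BondConfig V), Disjoint u N → (∀ g ∈ N ∪ u, ∀ w ∈ g, w ∈ T) →
      2 * T.card ≤ N.ncard + 2 * u.ncard + 2 →
      fibreCount N u (forestEv V ∩ {ω | s(o, v) ∈ ω ∧ s(o, y) ∈ ω}) (forestEv V) ≤
        fibreCount N u (forestEv V ∩ {ω | s(o, v) ∈ ω}) (forestEv V ∩ {ω | s(o, y) ∈ ω})) {M' u₀ : BondConfig V} {z h i : V} (hd : Disjoint u₀ M')
    (hz : ∀ g ∈ M' ∪ u₀, z ∉ g) (hzh : z ≠ h) (hzi : z ≠ i) (hhi : h ≠ i) (hzo : z ≠ o) (hzv : z ≠ v) (hzy : z ≠ y)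
    (hT : ∀ g ∈ M' ∪ u₀, ∀ w ∈ g, w ∈ T) (hh : h ∈ T) (hi : i ∈ T)
    (hnt : 2 * T.card ≤ M'.ncard + 2 * u₀.ncard + 3) (he : s(o, v) ∈ M') (hf : s(o, y) ∈ M') (hvy : v ≠ y) :
    fibreCount (insert s(z, i) M') (insert s(z, h) u₀) (forestEv V ∩ {ω | s(o, v) ∈ ω ∧ s(o, y) ∈ ω}) (forestEv V) ≤
      fibreCount (insert s(z, i) M') (insert s(z, h) u₀) (forestEv V ∩ {ω | s(o, v) ∈ ω}) (forestEv V ∩ {ω | s(o, y) ∈ ω}) := by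
  have hPi := insert_mem_pairEv₂_iff (mk_ne_of_far (a := i) hzo hzv) (mk_ne_of_far (a := i) hzo hzy)
  have hPh := insert_mem_pairEv₂_iff (mk_ne_of_far (a := h) hzo hzv) (mk_ne_of_far (a := h) hzo hzy)
  have hEi := insert_mem_pairEv_iff (mk_ne_of_far (a := i) hzo hzv)
  have hEh := insert_mem_pairEv_iff (mk_ne_of_far (a := h) hzo hzv)
  have hFi := insert_mem_pairEv_iff (mk_ne_of_far (a := i) hzo hzy)
  have hFh := insert_mem_pairEv_iff (mk_ne_of_far (a := h) hzo hzy)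
  have hU : ∀ x : V, ∀ ω, insert s(z, x) ω ∈ (univ : Set (BondConfig V)) ↔ ω ∈ (univ : Set (BondConfig V)) := fun _ _ => by simp
  have hb0 : fibreCount (insert s(z, i) M') (insert s(z, h) u₀) (forestEv V ∩ {ω | s(o, v) ∈ ω ∧ s(o, y) ∈ ω}) (forestEv V) =
      fibreCount (insert s(z, i) M') (insert s(z, h) u₀) (forestEv V ∩ {ω | s(o, v) ∈ ω ∧ s(o, y) ∈ ω}) (forestEv V ∩ univ) := by
    rw [inter_univ]
  rw [hb0, fibreCount_forest_mixed_decomp hz hzh hzi hhi hPi hPh (hU i) (hU h),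
    fibreCount_forest_mixed_decomp hz hzh hzi hhi hEi hEh hFi hFh]
  exact treeLevel_pairCell_le IHT hd hT hnt he hf hvy hh hi hhi

/-- **Isolated far vertex**: no valid colouring, `bad = 0`. [cite: CibulkaHladkyLaCroixWagner2008, Cases 0–1 (p. 4)] -/
theorem treeLevel_bad_eq_zero_of_isolated {M u₀ : BondConfig V} {S : Finset V} {z : V} (hS : ∀ g ∈ M ∪ u₀, ∀ w ∈ g, w ∈ S)
    (ht : 2 * S.card ≤ M.ncard + 2 * u₀.ncard + 2) (hz : ∀ g ∈ M ∪ u₀, z ∉ g) (hzS : z ∈ S) (hoS : o ∈ S) (hzo : z ≠ o) :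
    fibreCount M u₀ (forestEv V ∩ {ω | s(o, v) ∈ ω ∧ s(o, y) ∈ ω}) (forestEv V) = 0 :=
  fibreCount_eq_zero_of_forall M u₀ _ _ fun _ hω hA hB =>
    not_reachable_of_isolated (fun g hg => hz g ((subset_union_of_fibre hω).1 hg)) hzo.symm
      (reachable_of_tight hS ht hω hA.1 hB hzS hoS)

/-- **Far vertex of degree one**: no valid colouring, `bad = 0`. [cite: CibulkaHladkyLaCroixWagner2008, Cases 0–1 (p. 4)] -/
theorem treeLevel_bad_eq_zero_of_degOne {M' u₀ : BondConfig V} {S : Finset V} {z c : V}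
    (hS : ∀ g ∈ insert s(z, c) M' ∪ u₀, ∀ w ∈ g, w ∈ S) (ht : 2 * S.card ≤ (insert s(z, c) M').ncard + 2 * u₀.ncard + 2)
    (hz : ∀ g ∈ M' ∪ u₀, z ∉ g) (hzS : z ∈ S) (hoS : o ∈ S) (hzo : z ≠ o) :
    fibreCount (insert s(z, c) M') u₀ (forestEv V ∩ {ω | s(o, v) ∈ ω ∧ s(o, y) ∈ ω}) (forestEv V) = 0 := by
  refine fibreCount_eq_zero_of_forall _ u₀ _ _ fun ω hω hA hB => ?_
  have hsub := subset_union_of_fibre hω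
  have hzcM : s(z, c) ∈ insert s(z, c) M' := mem_insert _ _
  -- a pair at `z` on the fibre is the pair `zc`
  have only : ∀ g ∈ insert s(z, c) M' ∪ u₀, z ∈ g → g = s(z, c) := by
    intro g hg hzg
    rcases hg with hg | hg
    · rcases mem_insert_iff.1 hg with rfl | hg
      · rfl
      · exact absurd hzg (hz g (Or.inl hg))
    · exact absurd hzg (hz g (Or.inr hg))
  by_cases hzc : s(z, c) ∈ ω
  · -- `z` is isolated in the partner
    have hiso : ∀ g ∈ ω ∆ insert s(z, c) M', z ∉ g := fun g hg hzg => by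
      have := only g (hsub.2 hg) hzg
      subst this
      exact ((mem_symmDiff_iff_not_mem hzcM).1 hg) hzc
    exact not_reachable_of_isolated hiso hzo.symm (reachable_symmDiff_of_tight hS ht hω hA.1 hB hzS hoS)
  · have hiso : ∀ g ∈ ω, z ∉ g := fun g hg hzg => by
      have := only g (hsub.1 hg) hzg
      subst this
      exact hzc hg
    exact not_reachable_of_isolated hiso hzo.symm (reachable_of_tight hS ht hω hA.1 hB hzS hoS)

end Steps

/-! ### Degrees: counting pairs at a vertex -/

section Degree

omit [Fintype V] in
/-- **Handshake**: for a finite set `F` of non-diagonal pairs inside `S`, `Σ_{w ∈ S} #{g ∈ F : w ∈ g} = 2|F|`. [folklore] -/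
theorem sum_card_filter_mem_eq (F : Finset (Sym2 V)) (S : Finset V) (hF : ∀ g ∈ F, ¬ g.IsDiag)
    (hFS : ∀ g ∈ F, ∀ w ∈ g, w ∈ S) :
    ∑ w ∈ S, (F.filter fun g => w ∈ g).card = 2 * F.card := by
  have h1 : ∀ w ∈ S, (F.filter fun g => w ∈ g).card = ∑ g ∈ F, if w ∈ g then 1 else 0 :=
    fun w _ => Finset.card_filter _ _
  rw [Finset.sum_congr rfl h1, Finset.sum_comm]
  have h2 : ∀ g ∈ F, (∑ w ∈ S, if w ∈ g then 1 else 0) = 2 := by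
    intro g hg
    rw [← Finset.card_filter]
    induction g using Sym2.ind with
    | h a b =>
      have hab : a ≠ b := fun h => hF _ hg (Sym2.mk_isDiag_iff.2 h)
      have hfilt : (S.filter fun w => w ∈ s(a, b)) = {a, b} := by
        ext w
        simp only [Finset.mem_filter, Sym2.mem_iff, Finset.mem_insert, Finset.mem_singleton]
        constructor
        · exact fun h => h.2
        · rintro (rfl | rfl)
          · exact ⟨hFS _ hg _ (Sym2.mem_mk_left _ _), Or.inl rfl⟩
          · exact ⟨hFS _ hg _ (Sym2.mem_mk_right _ _), Or.inr rfl⟩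
      rw [hfilt, Finset.card_pair hab]
  rw [Finset.sum_congr rfl h2, Finset.sum_const, smul_eq_mul, mul_comm]

variable {M : BondConfig V} {z : V}

/-- No pair of `M` at `z`. [folklore] -/
theorem isolated_of_card_filter_eq_zero (h : ((toFinite M).toFinset.filter fun g => z ∈ g).card = 0) : ∀ g ∈ M, z ∉ g := by
  intro g hg hzg
  have : g ∈ (toFinite M).toFinset.filter fun g => z ∈ g :=
    Finset.mem_filter.2 ⟨(Set.Finite.mem_toFinset _).2 hg, hzg⟩
  rw [Finset.card_eq_zero.1 h] at this
  exact absurd this (Finset.notMem_empty _)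

/-- Exactly one pair of `M` at `z`: it is `za` for some `a ≠ z`. [folklore] -/
theorem exists_of_card_filter_eq_one (hM : ∀ g ∈ M, ¬ g.IsDiag) (h : ((toFinite M).toFinset.filter fun g => z ∈ g).card = 1) :
    ∃ a, z ≠ a ∧ s(z, a) ∈ M ∧ ∀ g ∈ M, z ∈ g → g = s(z, a) := by
  obtain ⟨g, hg⟩ := Finset.card_eq_one.1 h
  have hgF : g ∈ (toFinite M).toFinset.filter fun g => z ∈ g := by rw [hg]; exact Finset.mem_singleton_self _
  obtain ⟨hgM, hzg⟩ := Finset.mem_filter.1 hgF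
  have hgM' : g ∈ M := (Set.Finite.mem_toFinset _).1 hgM
  obtain ⟨a, rfl⟩ := Sym2.mem_iff_exists.1 hzg
  refine ⟨a, fun h' => hM _ hgM' (Sym2.mk_isDiag_iff.2 h'), hgM', fun g' hg' hzg' => ?_⟩
  have : g' ∈ (toFinite M).toFinset.filter fun g => z ∈ g := Finset.mem_filter.2 ⟨(Set.Finite.mem_toFinset _).2 hg', hzg'⟩
  rw [hg] at this
  exact Finset.mem_singleton.1 this

/-- Exactly two pairs of `M` at `z`: `za, zb` with `z, a, b` distinct. [folklore] -/
theorem exists_of_card_filter_eq_two (hM : ∀ g ∈ M, ¬ g.IsDiag) (h : ((toFinite M).toFinset.filter fun g => z ∈ g).card = 2) :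
    ∃ a b, z ≠ a ∧ z ≠ b ∧ a ≠ b ∧ s(z, a) ∈ M ∧ s(z, b) ∈ M ∧ ∀ g ∈ M, z ∈ g → g = s(z, a) ∨ g = s(z, b) := by
  obtain ⟨g₁, g₂, h12, hg⟩ := Finset.card_eq_two.1 h
  have mem : ∀ {g}, g ∈ ({g₁, g₂} : Finset (Sym2 V)) → g ∈ M ∧ z ∈ g := fun {g} hg' => by
    rw [← hg] at hg'
    obtain ⟨h1, h2⟩ := Finset.mem_filter.1 hg'
    exact ⟨(Set.Finite.mem_toFinset _).1 h1, h2⟩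
  obtain ⟨h1M, hz1⟩ := mem (Finset.mem_insert_self _ _)
  obtain ⟨h2M, hz2⟩ := mem (Finset.mem_insert_of_mem (Finset.mem_singleton_self _))
  obtain ⟨a, rfl⟩ := Sym2.mem_iff_exists.1 hz1
  obtain ⟨b, rfl⟩ := Sym2.mem_iff_exists.1 hz2
  refine ⟨a, b, fun h' => hM _ h1M (Sym2.mk_isDiag_iff.2 h'), fun h' => hM _ h2M (Sym2.mk_isDiag_iff.2 h'),
    fun h' => h12 (by rw [h']), h1M, h2M, fun g' hg' hzg' => ?_⟩
  have : g' ∈ (toFinite M).toFinset.filter fun g => z ∈ g := Finset.mem_filter.2 ⟨(Set.Finite.mem_toFinset _).2 hg', hzg'⟩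
  rw [hg, Finset.mem_insert, Finset.mem_singleton] at this
  exact this

/-- Exactly three pairs of `M` at `z`: `za, zb, zc` with `z, a, b, c` distinct. [folklore] -/
theorem exists_of_card_filter_eq_three (hM : ∀ g ∈ M, ¬ g.IsDiag) (h : ((toFinite M).toFinset.filter fun g => z ∈ g).card = 3) :
    ∃ a b c, z ≠ a ∧ z ≠ b ∧ z ≠ c ∧ a ≠ b ∧ a ≠ c ∧ b ≠ c ∧ s(z, a) ∈ M ∧ s(z, b) ∈ M ∧ s(z, c) ∈ M ∧
      ∀ g ∈ M, z ∈ g → g = s(z, a) ∨ g = s(z, b) ∨ g = s(z, c) := by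
  obtain ⟨g₁, g₂, g₃, h12, h13, h23, hg⟩ := Finset.card_eq_three.1 h
  have mem : ∀ {g}, g ∈ ({g₁, g₂, g₃} : Finset (Sym2 V)) → g ∈ M ∧ z ∈ g := fun {g} hg' => by
    rw [← hg] at hg'
    obtain ⟨h1, h2⟩ := Finset.mem_filter.1 hg'
    exact ⟨(Set.Finite.mem_toFinset _).1 h1, h2⟩
  obtain ⟨h1M, hz1⟩ := mem (Finset.mem_insert_self _ _)
  obtain ⟨h2M, hz2⟩ := mem (Finset.mem_insert_of_mem (Finset.mem_insert_self _ _))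
  obtain ⟨h3M, hz3⟩ := mem (Finset.mem_insert_of_mem (Finset.mem_insert_of_mem (Finset.mem_singleton_self _)))
  obtain ⟨a, rfl⟩ := Sym2.mem_iff_exists.1 hz1
  obtain ⟨b, rfl⟩ := Sym2.mem_iff_exists.1 hz2
  obtain ⟨c, rfl⟩ := Sym2.mem_iff_exists.1 hz3
  refine ⟨a, b, c, fun h' => hM _ h1M (Sym2.mk_isDiag_iff.2 h'), fun h' => hM _ h2M (Sym2.mk_isDiag_iff.2 h'),
    fun h' => hM _ h3M (Sym2.mk_isDiag_iff.2 h'), fun h' => h12 (by rw [h']), fun h' => h13 (by rw [h']),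
    fun h' => h23 (by rw [h']), h1M, h2M, h3M, fun g' hg' hzg' => ?_⟩
  have : g' ∈ (toFinite M).toFinset.filter fun g => z ∈ g := Finset.mem_filter.2 ⟨(Set.Finite.mem_toFinset _).2 hg', hzg'⟩
  rw [hg, Finset.mem_insert, Finset.mem_insert, Finset.mem_singleton] at this
  exact this

/-- At least two pairs of `M` at `o` when `e = ov ≠ f = oy` are in `M`. [folklore] -/
theorem two_le_card_filter {o v y : V} (he : s(o, v) ∈ M) (hf : s(o, y) ∈ M) (hvy : v ≠ y) :
    2 ≤ ((toFinite M).toFinset.filter fun g => o ∈ g).card := by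
  have hef : s(o, v) ≠ s(o, y) := fun h' => hvy (Sym2.congr_right.1 h')
  calc 2 = ({s(o, v), s(o, y)} : Finset (Sym2 V)).card := (Finset.card_pair hef).symm
    _ ≤ ((toFinite M).toFinset.filter fun g => o ∈ g).card := by
      refine Finset.card_le_card fun g hg => ?_
      rw [Finset.mem_insert, Finset.mem_singleton] at hg
      rcases hg with rfl | rfl
      · exact Finset.mem_filter.2 ⟨(Set.Finite.mem_toFinset _).2 he, Sym2.mem_mk_left _ _⟩
      · exact Finset.mem_filter.2 ⟨(Set.Finite.mem_toFinset _).2 hf, Sym2.mem_mk_left _ _⟩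

end Degree


/-! ### An end of degree at most two -/

section LowEnd

variable {M u₀ : BondConfig V} {S : Finset V} {o v y : V}

/-- **An end of weighted degree at most two** (CHLW Case 2(ii) at tree level): if `v` meets at most two pairs of the tight fibre
(pinned pairs counted twice), then `bad ≤ good`. [cite: CibulkaHladkyLaCroixWagner2008, Case 2(ii) (p. 4)] [cite: Linusson2011, Prop. 2.6] -/
theorem treeLevel_of_lowEnd (hS : ∀ g ∈ M ∪ u₀, ∀ w ∈ g, w ∈ S) (ht : 2 * S.card ≤ M.ncard + 2 * u₀.ncard + 2)
    (hdiag : ∀ g ∈ M ∪ u₀, ¬ g.IsDiag) (he : s(o, v) ∈ M) (hov : o ≠ v) (hvy : v ≠ y) (hoS : o ∈ S) (hvS : v ∈ S)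
    (hdeg : ((toFinite M).toFinset.filter fun g => v ∈ g).card + 2 * ((toFinite u₀).toFinset.filter fun g => v ∈ g).card ≤ 2) :
    fibreCount M u₀ (forestEv V ∩ {ω | s(o, v) ∈ ω ∧ s(o, y) ∈ ω}) (forestEv V) ≤
      fibreCount M u₀ (forestEv V ∩ {ω | s(o, v) ∈ ω}) (forestEv V ∩ {ω | s(o, y) ∈ ω}) := by
  have hMd : ∀ g ∈ M, ¬ g.IsDiag := fun g hg => hdiag g (Or.inl hg)
  have h1 : 1 ≤ ((toFinite M).toFinset.filter fun g => v ∈ g).card :=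
    Finset.card_pos.2 ⟨_, Finset.mem_filter.2 ⟨(Set.Finite.mem_toFinset _).2 he, Sym2.mem_mk_right _ _⟩⟩
  have hu0 : ((toFinite u₀).toFinset.filter fun g => v ∈ g).card = 0 := by omega
  have hu := isolated_of_card_filter_eq_zero hu0
  -- if `e` is the only pair at `v` in the configuration `ω`, then `v` is isolated in the partner: no valid colouring
  have key : ∀ (P : Set (BondConfig V)), (∀ ω, ω \ M = u₀ → ω ∈ P → s(o, v) ∈ ω ∧ ∀ g ∈ M, v ∈ g → g ∈ ω) →
      fibreCount M u₀ (forestEv V ∩ P) (forestEv V) = 0 := by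
    intro P hP
    refine fibreCount_eq_zero_of_forall M u₀ _ _ fun ω hω hA hB => ?_
    obtain ⟨heω, hall⟩ := hP ω hω hA.2
    have hiso : ∀ g ∈ ω ∆ M, v ∉ g := fun g hg hvg => by
      rcases (subset_union_of_fibre hω).2 hg with hgM | hgu
      · exact (mem_symmDiff_iff_not_mem hgM).1 hg (hall g hgM hvg)
      · exact hu g hgu hvg
    exact not_reachable_of_isolated hiso hov (reachable_symmDiff_of_tight hS ht hω hA.1 hB hvS hoS)
  rcases Nat.lt_or_ge ((toFinite M).toFinset.filter fun g => v ∈ g).card 2 with hlt | hge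
  · -- `e` is the only pair at `v`
    obtain ⟨a, -, haM, honly⟩ := exists_of_card_filter_eq_one (z := v) hMd (by omega)
    have hea : s(o, v) = s(v, a) := honly _ he (Sym2.mem_mk_right _ _)
    rw [key {ω | s(o, v) ∈ ω ∧ s(o, y) ∈ ω} fun ω _ hω' => ⟨hω'.1, fun g hg hvg => (honly g hg hvg).symm ▸ hea ▸ hω'.1⟩]
    exact Nat.zero_le _
  · -- `e` and one more free pair `g = vw`
    obtain ⟨a, b, hva, hvb, hab, haM, hbM, honly⟩ := exists_of_card_filter_eq_two (z := v) hMd (by omega)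
    -- one of the two is `e`; call the other `g = vw`
    obtain ⟨w, hvw, hgM, hge, honly'⟩ : ∃ w, v ≠ w ∧ s(v, w) ∈ M ∧ s(v, w) ≠ s(o, v) ∧
        ∀ g ∈ M, v ∈ g → g = s(o, v) ∨ g = s(v, w) := by
      rcases honly _ he (Sym2.mem_mk_right _ _) with h' | h'
      · exact ⟨b, hvb, hbM, fun h'' => hab (Sym2.congr_right.1 (h''.trans h')).symm,
          fun g hg hvg => (honly g hg hvg).imp (fun h'' => h''.trans h'.symm) id⟩
      · exact ⟨a, hva, haM, fun h'' => hab (Sym2.congr_right.1 (h''.trans h')),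
          fun g hg hvg => (honly g hg hvg).symm.imp (fun h'' => h''.trans h'.symm) id⟩
    have how : o ≠ w := fun h' => hge (by rw [← h', Sym2.eq_swap])
    have hv : ∀ p ∈ M ∪ u₀, v ∈ p → p = s(o, v) ∨ p = s(v, w) := fun p hp hvp => by
      rcases hp with hp | hp
      · exact honly' p hp hvp
      · exact absurd hvp (hu p hp)
    rw [fibreCount_split_pred M u₀ (forestEv V ∩ {ω | s(o, v) ∈ ω ∧ s(o, y) ∈ ω}) (forestEv V) {ω | s(v, w) ∉ ω}]
    have h0 : fibreCount M u₀ (forestEv V ∩ {ω | s(o, v) ∈ ω ∧ s(o, y) ∈ ω} ∩ {ω | s(v, w) ∉ ω}ᶜ) (forestEv V) = 0 := by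
      rw [inter_assoc]
      refine key _ fun ω _ hω' => ⟨hω'.1.1, fun g hg hvg => ?_⟩
      rcases honly' g hg hvg with rfl | rfl
      · exact hω'.1.1
      · exact not_not.1 hω'.2
    rw [h0, add_zero]
    exact adjForestNoSq_bad_sdiff_le_good_of_degTwo hov hvw how hvy he hgM hv

end LowEnd

end FK
end Summit.CriticalPhenomena.PercolationContinuityZ3.Theorems

end
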